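import Mathlib
import Summits.Ventures.HodgeRepro2.LevelPositivity

/-!
# «Sufficiently small» levels, neat levels, and the lattice of admissible levels

Kernel annex of sub-claim B5 (single-level positivity + level), file 4. This file formalises the
topological-group content of Lemma B5.8 (the phrase «sufficiently small») and of
Proposition B5.3(a) (the set `𝓛` of admissible levels) of the owner section `route/T4-B5-p8.md`.
Nothing arithmetic is asserted: the printed facts (the three «sufficiently small» assertions
P₁, P₂, P₃ of Liu 2021 — Prop. C.5, Thm. 4.18(1), Cor. 4.20 — and the printed existence of a neat
compact open subgroup inside any compact open subgroup, Ullmo–Yafaev 2014 / Daw 2015) enter as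
HYPOTHESES of the statements below.

* `EventuallySmall P` — reading (SS) of «P(K) holds for every sufficiently small open compact K»:
  there is an open compact threshold below which P holds at every open compact subgroup.
* `Elementwise p K` — an elementwise property of subgroups (the printed definition of «neat»,
  Bergeron–Millson–Moeglin §1.4, is of this form); it is hereditary (`Elementwise.mono`, (N1)).
* `eventuallySmall_forall` — finitely many «sufficiently small» assertions have a common threshold
  (Lemma B5.8, reading (SS)).
* `isOpen_isCompact_of_isClosed_of_finiteIndex` — what is TRUE in place of the withdrawn v1 step
  «a finite-index subgroup of an open compact subgroup is open compact» (ref-4 R4-B5-1 / ref-3 F-8):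
  a CLOSED subgroup of finite index in an open compact subgroup is open and compact.
* `exists_neat_threshold` — Lemma B5.8, the neat clause: under hypothesis (N2) the threshold can be
  taken neat, and then every open compact subgroup of it is neat and satisfies P₁, P₂, P₃.
* `eventuallySmall_of_forall_neat` — reading (N): an assertion holding at every neat open compact
  subgroup is «sufficiently small» in the sense (SS), given (N2).
* `singleLevelPositivity_neat` — Theorem B5.1 (i)–(iii) in abstract form with clause (i) complete:
  the level of `singleLevelPositivity` (file 1) can be taken below a neat common threshold.
* `levelsBelow K` — Proposition B5.3(a): the admissible levels below `K` form a non-empty set,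
  closed under finite intersections and under passing to open compact subgroups, and every member
  inherits any property that holds at every open compact subgroup of `K`.
-/

namespace Summit.Ventures.HodgeRepro2.LevelPositivity

open Module

variable {G : Type*} [Group G]

/-- An elementwise property of subgroups: every element of `K` has the property `p`. The printed
definition of «neat» (Bergeron–Millson–Moeglin, Acta Math. 216 (2016) §1.4) is of this form. -/
def Elementwise (p : G → Prop) (K : Subgroup G) : Prop :=
  ∀ k ∈ K, p k

/-- (N1): an elementwise property is inherited by subgroups. -/
theorem Elementwise.mono {p : G → Prop} {K K' : Subgroup G} (h : Elementwise p K) (hle : K' ≤ K) :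
    Elementwise p K' :=
  fun k hk => h k (hle hk)

/-- A property that holds at a subgroup holds at the intersection with any subgroup. -/
theorem Elementwise.inf_left {p : G → Prop} {K K' : Subgroup G} (h : Elementwise p K) :
    Elementwise p (K ⊓ K') :=
  h.mono inf_le_left

variable [TopologicalSpace G]

/-- Reading (SS) of the printed phrase «`P K` holds for every sufficiently small open compact
subgroup `K`»: there is an open compact threshold `K₀` such that `P K` holds for every open compact
subgroup `K ≤ K₀`. -/
def EventuallySmall (P : OpenSubgroup G → Prop) : Prop :=
  ∃ K₀ : OpenSubgroup G, IsCompact (K₀ : Set G) ∧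
    ∀ K : OpenSubgroup G, IsCompact (K : Set G) → K ≤ K₀ → P K

section ClosedFiniteIndex

variable [IsTopologicalGroup G]

/-- The repair of the withdrawn v1 step of Lemma B5.8 (ref-4 R4-B5-1, ref-3 F-8, ref-2 N-B5.8a):
«a finite-index subgroup of an open compact subgroup is open compact» is false in general, but a
CLOSED subgroup `H` of finite index in an open compact subgroup `K₀` is open and compact. The proof
applies Mathlib's `Subgroup.isOpen_of_isClosed_of_finiteIndex` inside the topological group `K₀`
and transports the result along the open embedding `K₀ → G`. -/
theorem isOpen_isCompact_of_isClosed_of_finiteIndex (K₀ : Subgroup G) (hK₀o : IsOpen (K₀ : Set G))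
    (hK₀c : IsCompact (K₀ : Set G)) (H : Subgroup G) (hle : H ≤ K₀) (hcl : IsClosed (H : Set G))
    [(H.subgroupOf K₀).FiniteIndex] : IsOpen (H : Set G) ∧ IsCompact (H : Set G) := by
  refine ⟨?_, IsCompact.of_isClosed_subset hK₀c hcl hle⟩
  have hset : ((H.subgroupOf K₀ : Subgroup K₀) : Set K₀) = Subtype.val ⁻¹' (H : Set G) := by
    ext x
    simp [Subgroup.mem_subgroupOf]
  have hcl' : IsClosed ((H.subgroupOf K₀ : Subgroup K₀) : Set K₀) := by
    rw [hset]
    exact hcl.preimage continuous_subtype_val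
  have hop' : IsOpen ((H.subgroupOf K₀ : Subgroup K₀) : Set K₀) :=
    Subgroup.isOpen_of_isClosed_of_finiteIndex _ hcl'
  have himg : Subtype.val '' ((H.subgroupOf K₀ : Subgroup K₀) : Set K₀) = (H : Set G) := by
    ext x
    constructor
    · rintro ⟨y, hy, rfl⟩
      exact Subgroup.mem_subgroupOf.1 hy
    · intro hx
      exact ⟨⟨x, hle hx⟩, Subgroup.mem_subgroupOf.2 hx, rfl⟩
  rw [← himg]
  exact hK₀o.isOpenMap_subtype_val _ hop'

/-- The same statement with the ambient open compact subgroup given as an `OpenSubgroup`, packaged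
as an `OpenSubgroup` together with its compactness. -/
theorem exists_openSubgroup_of_isClosed_of_finiteIndex (K₀ : OpenSubgroup G)
    (hK₀c : IsCompact (K₀ : Set G)) (H : Subgroup G) (hle : H ≤ K₀.toSubgroup)
    (hcl : IsClosed (H : Set G)) [(H.subgroupOf K₀.toSubgroup).FiniteIndex] :
    ∃ U : OpenSubgroup G, U.toSubgroup = H ∧ IsCompact (U : Set G) := by
  obtain ⟨ho, hc⟩ :=
    isOpen_isCompact_of_isClosed_of_finiteIndex K₀.toSubgroup K₀.isOpen hK₀c H hle hcl
  exact ⟨⟨H, ho⟩, rfl, hc⟩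

end ClosedFiniteIndex

/-- Hypothesis (N2) of Lemma B5.8, as printed (Ullmo–Yafaev 2014, Daw 2015): every compact open
subgroup contains a neat compact open subgroup. `neat` is any elementwise property. -/
def NeatInside (neat : G → Prop) : Prop :=
  ∀ K : OpenSubgroup G, IsCompact (K : Set G) →
    ∃ K' : OpenSubgroup G, IsCompact (K' : Set G) ∧ K' ≤ K ∧ Elementwise neat K'.toSubgroup

/-- Reading (N) of «sufficiently small» (= «neat», the word printed for the index set of the
coherent systems): an assertion that holds at every neat open compact subgroup is «sufficiently
small» in the sense (SS), given (N2). -/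
theorem eventuallySmall_of_forall_neat (neat : G → Prop) (hN2 : NeatInside neat)
    (P : OpenSubgroup G → Prop)
    (hP : ∀ K : OpenSubgroup G, IsCompact (K : Set G) → Elementwise neat K.toSubgroup → P K)
    (K₀ : OpenSubgroup G) (hK₀ : IsCompact (K₀ : Set G)) : EventuallySmall P := by
  obtain ⟨K', hK'c, -, hK'neat⟩ := hN2 K₀ hK₀
  exact ⟨K', hK'c, fun K hK hle => hP K hK (hK'neat.mono hle)⟩

section Thresholds

variable [IsTopologicalGroup G]

/-- Lemma B5.8, reading (SS): finitely many assertions `P i`, each holding for every sufficiently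
small open compact subgroup, hold simultaneously at every open compact subgroup of one common
threshold `K₁`, which can be taken inside any given open compact `K₀`. The threshold is the
`commonLevel` of file 1 (the finite intersection `K₀ ⊓ ⨅ i, K_{P i}`). -/
theorem eventuallySmall_forall {ι : Type*} [Finite ι] (P : ι → OpenSubgroup G → Prop)
    (hP : ∀ i, EventuallySmall (P i)) (K₀ : OpenSubgroup G) (hK₀ : IsCompact (K₀ : Set G)) :
    ∃ K₁ : OpenSubgroup G, IsCompact (K₁ : Set G) ∧ K₁ ≤ K₀ ∧
      ∀ K : OpenSubgroup G, IsCompact (K : Set G) → K ≤ K₁ → ∀ i, P i K := by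
  choose S hS using hP
  refine ⟨commonLevel K₀ S, isCompact_commonLevel K₀ S hK₀, commonLevel_le K₀ S, ?_⟩
  intro K hK hle i
  exact (hS i).2 K hK (hle.trans (commonLevel_le_apply K₀ S i))

/-- Lemma B5.8, the neat clause: under (N2), finitely many «sufficiently small» assertions have a
common threshold `K₁` that is neat, inside any given open compact `K₀`; every open compact subgroup
`K ≤ K₁` is then neat ((N1), `Elementwise.mono`) and satisfies every `P i`. -/
theorem exists_neat_threshold (neat : G → Prop) (hN2 : NeatInside neat) {ι : Type*} [Finite ι]
    (P : ι → OpenSubgroup G → Prop) (hP : ∀ i, EventuallySmall (P i)) (K₀ : OpenSubgroup G)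
    (hK₀ : IsCompact (K₀ : Set G)) :
    ∃ K₁ : OpenSubgroup G, IsCompact (K₁ : Set G) ∧ K₁ ≤ K₀ ∧ Elementwise neat K₁.toSubgroup ∧
      ∀ K : OpenSubgroup G, IsCompact (K : Set G) → K ≤ K₁ →
        (∀ i, P i K) ∧ Elementwise neat K.toSubgroup := by
  obtain ⟨K₂, hK₂c, hK₂le, hK₂⟩ := eventuallySmall_forall P hP K₀ hK₀
  obtain ⟨K₁, hK₁c, hK₁le, hK₁neat⟩ := hN2 K₂ hK₂c
  refine ⟨K₁, hK₁c, hK₁le.trans hK₂le, hK₁neat, ?_⟩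
  intro K hK hle
  exact ⟨hK₂ K hK (hle.trans hK₁le), hK₁neat.mono hle⟩

/-- Theorem B5.1 (i)–(iii) in abstract form, clause (i) complete: given the thresholds of the three
printed «sufficiently small» assertions (hypotheses `hP`), the printed (N2) (hypothesis `hN2`),
finitely many smooth representations `ω i j` with distinguished non-zero vectors `v i ∈ ω i (j₀ i)`
and admissibility (`hadm`), there is an open compact level `K ≤ K₀` such that every open compact
`K' ≤ K` is neat, satisfies every `P i` (clause (i)), has every count
`∑ j ∈ s, finrank (ω i j)^{K'} ≥ 1` for `s ∋ j₀ i` (clause (ii)), and the counts are antitone in the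
level (clause (iii)). Composition of `exists_neat_threshold` with `singleLevelPositivity` (file 1). -/
theorem singleLevelPositivity_neat {k : Type*} [Field k] (neat : G → Prop) (hN2 : NeatInside neat)
    {ι₀ : Type*} [Finite ι₀] (P : ι₀ → OpenSubgroup G → Prop) (hP : ∀ i, EventuallySmall (P i))
    {ι : Type*} [Finite ι] (J : ι → Type*) (W : ∀ i, J i → Type*)
    [∀ i j, AddCommGroup (W i j)] [∀ i j, Module k (W i j)]
    (ω : ∀ i j, Representation k G (W i j)) (hsmooth : ∀ i j, IsSmooth (ω i j))
    (j₀ : ∀ i, J i) (v : ∀ i, W i (j₀ i)) (hv : ∀ i, v i ≠ 0)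
    (K₀ : OpenSubgroup G) (hK₀ : IsCompact (K₀ : Set G))
    (hadm : ∀ i j (K' : OpenSubgroup G), IsCompact (K' : Set G) →
      FiniteDimensional k (invariants (ω i j) K'.toSubgroup)) :
    ∃ K : OpenSubgroup G, IsCompact (K : Set G) ∧ K ≤ K₀ ∧
      (∀ K' : OpenSubgroup G, IsCompact (K' : Set G) → K' ≤ K →
        Elementwise neat K'.toSubgroup ∧ ∀ i, P i K') ∧
      (∀ K' ≤ K, IsCompact (K' : Set G) → ∀ i (s : Finset (J i)), j₀ i ∈ s →
        1 ≤ ∑ j ∈ s, finrank k (invariants (ω i j) K'.toSubgroup)) ∧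
      (∀ K' K'' : OpenSubgroup G, K'' ≤ K' → K' ≤ K → IsCompact (K'' : Set G) →
        ∀ i (s : Finset (J i)),
          ∑ j ∈ s, finrank k (invariants (ω i j) K'.toSubgroup) ≤
            ∑ j ∈ s, finrank k (invariants (ω i j) K''.toSubgroup)) := by
  obtain ⟨K₁, hK₁c, hK₁le, -, hK₁⟩ := exists_neat_threshold neat hN2 P hP K₀ hK₀
  obtain ⟨K, hKc, hKle, hpos, hmono⟩ :=
    singleLevelPositivity J W ω hsmooth j₀ v hv K₁ hK₁c hadm
  refine ⟨K, hKc, hKle.trans hK₁le, ?_, hpos, hmono⟩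
  intro K' hK'c hle
  obtain ⟨hP', hneat⟩ := hK₁ K' hK'c (hle.trans hKle)
  exact ⟨hneat, hP'⟩

end Thresholds

section Lattice

/-- Proposition B5.3(a): the set `𝓛` of admissible levels below `K` — the open compact subgroups
contained in `K`. -/
def levelsBelow (K : OpenSubgroup G) : Set (OpenSubgroup G) :=
  {K' | IsCompact (K' : Set G) ∧ K' ≤ K}

/-- Membership in `𝓛`: an open compact subgroup contained in `K`. -/
theorem mem_levelsBelow {K K' : OpenSubgroup G} :
    K' ∈ levelsBelow K ↔ IsCompact (K' : Set G) ∧ K' ≤ K :=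
  Iff.rfl

/-- `𝓛` is non-empty: it contains `K` itself. -/
theorem self_mem_levelsBelow {K : OpenSubgroup G} (hK : IsCompact (K : Set G)) :
    K ∈ levelsBelow K :=
  ⟨hK, le_rfl⟩

/-- `𝓛` is closed under (finite) intersections — in the stronger form: the intersection of a
member with ANY open subgroup is a member. -/
theorem inf_mem_levelsBelow [IsTopologicalGroup G] {K K₁ : OpenSubgroup G}
    (h₁ : K₁ ∈ levelsBelow K) (K₂ : OpenSubgroup G) : K₁ ⊓ K₂ ∈ levelsBelow K :=
  ⟨isCompact_inf_of_isCompact_left K₁ K₂ h₁.1, inf_le_of_left_le h₁.2⟩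

/-- `𝓛` is closed under passing to open compact subgroups. -/
theorem mem_levelsBelow_of_le {K K' K'' : OpenSubgroup G} (h : K' ∈ levelsBelow K) (hle : K'' ≤ K')
    (hc : IsCompact (K'' : Set G)) : K'' ∈ levelsBelow K :=
  ⟨hc, hle.trans h.2⟩

/-- Every member of `𝓛` satisfies any property that holds at every open compact subgroup of `K`
(Theorem B5.1(iii)–(v) are of this form). -/
theorem forall_mem_levelsBelow {K : OpenSubgroup G} {Q : OpenSubgroup G → Prop}
    (hQ : ∀ K' : OpenSubgroup G, IsCompact (K' : Set G) → K' ≤ K → Q K') :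
    ∀ K' ∈ levelsBelow K, Q K' :=
  fun K' hK' => hQ K' hK'.1 hK'.2

/-- The set `𝓛` of Proposition B5.3(a) for the level `K = K₀ ⊓ ⨅ i, K_i` built from a threshold
`K₀` and finitely many open subgroups `K_i`: it contains the `commonLevel` itself. -/
theorem commonLevel_mem_levelsBelow [IsTopologicalGroup G] {ι : Type*} [Finite ι]
    (K₀ : OpenSubgroup G)
    (S : ι → OpenSubgroup G) (hK₀ : IsCompact (K₀ : Set G)) :
    commonLevel K₀ S ∈ levelsBelow (commonLevel K₀ S) :=
  self_mem_levelsBelow (isCompact_commonLevel K₀ S hK₀)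

end Lattice

end Summit.Ventures.HodgeRepro2.LevelPositivity
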